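import Mathlib
import Literature.Analysis.FluidPDE.RieszPressureL3
import Literature.Analysis.FluidPDE.RieszPressureSpaceTimeLp
import Literature.Analysis.FluidPDE.LerayHopfAssociatedPressure
import Summits.NavierStokesRegularity.NavierStokesRegularity.Theorems.RootDecompLitSliceCubicFluxBudget
import HarnessLib

/-!
# Route RootDecompLitSlice — cell Uᶜ `CritTameScarIsCritical` (stmt-NavierStokesRegularity-31733):
# the PRESSURE FLUX on a ball, SLICE FORM, from the GLOBAL (Stein) pressure bound

Helpers toward the Tao-vacuous cell Uᶜ (`--supports 31733`; no item, no node, no registered stub).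
The assembled scar law `LocalEnergyBudget.scar_le_of_pressureBudget` (landed) carries the pressure
flux `mpu ≥ ∬_{(T−τ,t₁)×B_R}|p − c(t)||u|` as its last hypothesis number. This file discharges it
CRUDELY — by the whole-space `L^{3/2}` bound of the associated pressure, no local pressure
decomposition: if `p − c(t) = p̃` a.e. with `‖p̃(t)‖_{3/2} ≤ C_{3/2}‖u(t)‖₃²` (the gauge data of
`PressureGauge.exists_gauge_associated_pressure`), then Hölder `(3/2, 3)` on the ball, the
interpolation `‖u‖₃² ≤ ‖u‖₂‖u‖₆`, `‖u‖_{L³(B)} ≤ ‖u‖^{1/2}_{L²(B)}‖u‖^{1/2}_{L⁶}`, Sobolev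
`‖u‖₆ ≤ K‖∇u‖₂` and Hölder `(4/3, 4)` in time give
`∬|p − c||u| ≤ C_{3/2} K^{3/2} ‖u₀‖₂ a^{1/4} τ^{1/4} G^{3/4}` (`a` = local energy on the window,
`G` = window enstrophy) — the cubic-flux budget `K^{3/2} a^{3/4} τ^{1/4} G^{3/4}` of the landed
`CubicFlux.cubicFlux_le` with `a^{3/4}` replaced by `C_{3/2}‖u₀‖₂ a^{1/4}`. Route-free:

* `PressureFlux.lintegral_enorm_cube_rpow_le`, `PressureFlux.lintegral_ball_enorm_cube_rpow_le` —
  the two interpolation factors `‖v‖₃² ≤ ‖v‖₂ K ‖∇v‖₂`, `‖v‖_{L³(B)} ≤ ‖v‖^{1/2}_{L²(B)} K^{1/2}‖∇v‖^{1/2}₂`;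
* `PressureFlux.slice_le` — `∫_{B}|π||v| ≤ C ‖v‖₂ ‖v‖^{1/2}_{L²(B)} K^{3/2} (∫|∇v|²_F)^{3/4}`
  whenever `‖π‖_{3/2} ≤ C‖v‖₃²`;
* `PressureFlux.integrable_slab` — `|p̃||u| ∈ L¹` of the slab (`p̃ ∈ L^{3/2}`, `u ∈ L³`, tree
  `IsLerayHopfOn.memLp_three_uncurry_slab`);
* `PressureFlux.young_optimise` — the optimisation `inf_κ (¾κG + ¼κ⁻³τ) = τ^{1/4}G^{3/4}` of the
  landed `CubicFlux.cubicFlux_le`, abstracted; the window theorems `pressureFlux_le_young`,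
  `pressureFlux_le` (Fubini + this slice bound + Young in time) are the sequel file
  `RootDecompLitSlicePressureFlux.lean`.

HONEST FRAMING: helper lemmas INSIDE the Tao-vacuous cell Uᶜ; zero load of the route moves
(ROOT ⟺ U ∧ P1, critic rows 354/371/563/639/665/678); no item is re-typed. Rung 0: nothing here
proves NS regularity. The bound is the CRUDE (global) pressure tier: it feeds the exponent
bookkeeping of the clock → scar law but cannot reach the endpoint clock `b = 1/2`.
Decomp-ns route-writer g40. [cite: CaffarelliKohnNirenberg1982, §2 (2.4)] [cite: Evans2010, §5.6.1 Thm. 1–2]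
-/

set_option linter.dupNamespace false

noncomputable section

namespace Summit.NavierStokesRegularity.NavierStokesRegularity.Theorems

open MeasureTheory TopologicalSpace Set Function Filter Metric
open _root_.Topology
open scoped InnerProductSpace RealInnerProductSpace ENNReal NNReal ContDiff
open Literature.Analysis.FluidPDE

namespace PressureFlux

/-- **`‖v‖₃² ≤ ‖v‖₂ · K · ‖∇v‖₂`** in lower-integral form: for a `C¹` field `v ∈ L²(ℝ³;ℝ³)`,
`(∫⁻‖v‖ₑ³)^{2/3} ≤ (∫⁻‖v‖ₑ²)^{1/2} · (K¹ · (∫⁻|∇v|²_F)^{1/2})`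
(Hölder `∫|v|³ ≤ (∫|v|²)^{3/4}(∫|v|⁶)^{1/4}`, tree `CubicFlux.lintegral_enorm_cube_le_holder`,
then Sobolev, tree `CubicFlux.lintegral_enorm_six_le_sobolev`). [cite: Evans2010, §5.6.1 Thm. 1–2] -/
theorem lintegral_enorm_cube_rpow_le
    (v : EuclideanSpace ℝ (Fin 3) → EuclideanSpace ℝ (Fin 3)) (hv : ContDiff ℝ 1 v)
    (hv2 : MemLp v 2 volume) :
    (∫⁻ x, ‖v x‖ₑ ^ 3) ^ (2 / 3 : ℝ) ≤
      (∫⁻ x, ‖v x‖ₑ ^ 2) ^ (1 / 2 : ℝ) *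
        (((SNormLESNormFDerivOfEqConst (EuclideanSpace ℝ (Fin 3))
            (volume : Measure (EuclideanSpace ℝ (Fin 3))) 2 : ℝ≥0∞) ^ (1 : ℝ)) *
          (∫⁻ x, ENNReal.ofReal (frobeniusNormSq (fderiv ℝ v x))) ^ (1 / 2 : ℝ)) := by
  set K : ℝ≥0 := SNormLESNormFDerivOfEqConst (EuclideanSpace ℝ (Fin 3))
    (volume : Measure (EuclideanSpace ℝ (Fin 3))) 2 with hK
  set Fv : ℝ≥0∞ := ∫⁻ x, ENNReal.ofReal (frobeniusNormSq (fderiv ℝ v x)) with hFv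
  have hH := CubicFlux.lintegral_enorm_cube_le_holder (volume : Measure (EuclideanSpace ℝ (Fin 3)))
    (hv.continuous.aestronglyMeasurable)
  have h6 := CubicFlux.lintegral_enorm_six_le_sobolev v hv hv2
  have h1 : ∫⁻ x, ‖v x‖ₑ ^ 3 ≤
      (∫⁻ x, ‖v x‖ₑ ^ 2) ^ (3 / 4 : ℝ) * (((K : ℝ≥0∞) ^ (6 : ℝ)) * Fv ^ (3 : ℝ)) ^ (4⁻¹ : ℝ) :=
    hH.trans (by gcongr)
  calc (∫⁻ x, ‖v x‖ₑ ^ 3) ^ (2 / 3 : ℝ)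
      ≤ ((∫⁻ x, ‖v x‖ₑ ^ 2) ^ (3 / 4 : ℝ) *
          (((K : ℝ≥0∞) ^ (6 : ℝ)) * Fv ^ (3 : ℝ)) ^ (4⁻¹ : ℝ)) ^ (2 / 3 : ℝ) := by gcongr
    _ = (∫⁻ x, ‖v x‖ₑ ^ 2) ^ (1 / 2 : ℝ) * (((K : ℝ≥0∞) ^ (1 : ℝ)) * Fv ^ (1 / 2 : ℝ)) := by
        have e1 : ((∫⁻ x, ‖v x‖ₑ ^ 2) ^ (3 / 4 : ℝ)) ^ (2 / 3 : ℝ) =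
            (∫⁻ x, ‖v x‖ₑ ^ 2) ^ (1 / 2 : ℝ) := by
          rw [← ENNReal.rpow_mul]; norm_num
        have e2 : ((((K : ℝ≥0∞) ^ (6 : ℝ)) * Fv ^ (3 : ℝ)) ^ (4⁻¹ : ℝ)) ^ (2 / 3 : ℝ) =
            ((K : ℝ≥0∞) ^ (1 : ℝ)) * Fv ^ (1 / 2 : ℝ) := by
          rw [← ENNReal.rpow_mul, ENNReal.mul_rpow_of_nonneg _ _ (by norm_num), ← ENNReal.rpow_mul,
            ← ENNReal.rpow_mul]
          norm_num
        rw [ENNReal.mul_rpow_of_nonneg _ _ (by norm_num), e1, e2]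

/-- **`‖v‖_{L³(B)} ≤ ‖v‖^{1/2}_{L²(B)} K^{1/2} ‖∇v‖^{1/2}₂`** in lower-integral form:
`(∫⁻_B‖v‖ₑ³)^{1/3} ≤ (∫⁻_B‖v‖ₑ²)^{1/4} · (K^{1/2} · (∫⁻|∇v|²_F)^{1/4})`
(tree `CubicFlux.lintegral_ball_enorm_cube_le`, cube root). [cite: Evans2010, §5.6.1 Thm. 1–2] -/
theorem lintegral_ball_enorm_cube_rpow_le
    (v : EuclideanSpace ℝ (Fin 3) → EuclideanSpace ℝ (Fin 3)) (hv : ContDiff ℝ 1 v)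
    (hv2 : MemLp v 2 volume) (x₀ : EuclideanSpace ℝ (Fin 3)) (R : ℝ) :
    (∫⁻ x in ball x₀ R, ‖v x‖ₑ ^ 3) ^ (3⁻¹ : ℝ) ≤
      (∫⁻ x in ball x₀ R, ‖v x‖ₑ ^ 2) ^ (4⁻¹ : ℝ) *
        (((SNormLESNormFDerivOfEqConst (EuclideanSpace ℝ (Fin 3))
            (volume : Measure (EuclideanSpace ℝ (Fin 3))) 2 : ℝ≥0∞) ^ (1 / 2 : ℝ)) *
          (∫⁻ x, ENNReal.ofReal (frobeniusNormSq (fderiv ℝ v x))) ^ (4⁻¹ : ℝ)) := by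
  set K : ℝ≥0 := SNormLESNormFDerivOfEqConst (EuclideanSpace ℝ (Fin 3))
    (volume : Measure (EuclideanSpace ℝ (Fin 3))) 2 with hK
  set Fv : ℝ≥0∞ := ∫⁻ x, ENNReal.ofReal (frobeniusNormSq (fderiv ℝ v x)) with hFv
  have h1 := CubicFlux.lintegral_ball_enorm_cube_le v hv hv2 x₀ R
  calc (∫⁻ x in ball x₀ R, ‖v x‖ₑ ^ 3) ^ (3⁻¹ : ℝ)
      ≤ ((∫⁻ x in ball x₀ R, ‖v x‖ₑ ^ 2) ^ (3 / 4 : ℝ) *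
          (((K : ℝ≥0∞) ^ (3 / 2 : ℝ)) * Fv ^ (3 / 4 : ℝ))) ^ (3⁻¹ : ℝ) := by gcongr
    _ = (∫⁻ x in ball x₀ R, ‖v x‖ₑ ^ 2) ^ (4⁻¹ : ℝ) *
          (((K : ℝ≥0∞) ^ (1 / 2 : ℝ)) * Fv ^ (4⁻¹ : ℝ)) := by
        rw [ENNReal.mul_rpow_of_nonneg _ _ (by norm_num), ENNReal.mul_rpow_of_nonneg _ _ (by norm_num),
          ← ENNReal.rpow_mul, ← ENNReal.rpow_mul, ← ENNReal.rpow_mul]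
        norm_num

/-- ★ **The pressure flux on a ball, slice form.** For a `C¹` field `v ∈ L²(ℝ³;ℝ³)` and an
a.e.-strongly measurable `π : ℝ³ → ℝ` with `‖π‖_{3/2} ≤ C‖v‖₃²` (Stein's bound for the
associated pressure): `∫⁻_{B(x₀,R)}‖π‖ₑ‖v‖ₑ ≤ C (∫⁻‖v‖ₑ²)^{1/2} (∫⁻_{B}‖v‖ₑ²)^{1/4} (K^{3/2}
(∫⁻|∇v|²_F)^{3/4})` (Hölder `(3/2,3)` on the ball, then the two interpolation lemmas).
[cite: Evans2010, §5.6.1 Thm. 1–2] -/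
theorem slice_le (v : EuclideanSpace ℝ (Fin 3) → EuclideanSpace ℝ (Fin 3)) (hv : ContDiff ℝ 1 v)
    (hv2 : MemLp v 2 volume) (π : EuclideanSpace ℝ (Fin 3) → ℝ)
    (hπm : AEStronglyMeasurable π volume) {C : ℝ≥0∞}
    (hπ : eLpNorm π (3 / 2 : ℝ≥0∞) volume ≤ C * eLpNorm v 3 volume ^ 2)
    (x₀ : EuclideanSpace ℝ (Fin 3)) (R : ℝ) :
    ∫⁻ x in ball x₀ R, ‖π x‖ₑ * ‖v x‖ₑ ≤
      C * (∫⁻ x, ‖v x‖ₑ ^ 2) ^ (1 / 2 : ℝ) * (∫⁻ x in ball x₀ R, ‖v x‖ₑ ^ 2) ^ (4⁻¹ : ℝ) *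
        (((SNormLESNormFDerivOfEqConst (EuclideanSpace ℝ (Fin 3))
            (volume : Measure (EuclideanSpace ℝ (Fin 3))) 2 : ℝ≥0∞) ^ (3 / 2 : ℝ)) *
          (∫⁻ x, ENNReal.ofReal (frobeniusNormSq (fderiv ℝ v x))) ^ (3 / 4 : ℝ)) := by
  set K : ℝ≥0 := SNormLESNormFDerivOfEqConst (EuclideanSpace ℝ (Fin 3))
    (volume : Measure (EuclideanSpace ℝ (Fin 3))) 2 with hK
  set Fv : ℝ≥0∞ := ∫⁻ x, ENNReal.ofReal (frobeniusNormSq (fderiv ℝ v x)) with hFv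
  set B : Set (EuclideanSpace ℝ (Fin 3)) := ball x₀ R with hB
  have hvm : AEStronglyMeasurable v (volume.restrict B) :=
    hv.continuous.aestronglyMeasurable
  have hH := ENNReal.lintegral_mul_le_Lp_mul_Lq (volume.restrict B)
    (Real.holderConjugate_iff.2 ⟨by norm_num, by norm_num⟩ : (3 / 2 : ℝ).HolderConjugate 3)
    (hπm.restrict.enorm) hvm.enorm
  simp only [Pi.mul_apply] at hH
  -- the pressure factor
  have hπB : (∫⁻ x in B, ‖π x‖ₑ ^ (3 / 2 : ℝ)) ^ (1 / (3 / 2) : ℝ) ≤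
      eLpNorm π (3 / 2 : ℝ≥0∞) volume := by
    rw [eLpNorm_eq_lintegral_rpow_enorm_toReal (by norm_num : (3 / 2 : ℝ≥0∞) ≠ 0)
      (ENNReal.div_ne_top (by norm_num) (by norm_num)),
      show ((3 / 2 : ℝ≥0∞)).toReal = (3 / 2 : ℝ) by rw [ENNReal.toReal_div]; norm_num]
    exact ENNReal.rpow_le_rpow (lintegral_mono' Measure.restrict_le_self le_rfl) (by norm_num)
  have hv3 : eLpNorm v 3 volume ^ 2 = (∫⁻ x, ‖v x‖ₑ ^ 3) ^ (2 / 3 : ℝ) := by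
    rw [eLpNorm_eq_lintegral_rpow_enorm_toReal (by norm_num) (by norm_num), ENNReal.toReal_ofNat,
      ← ENNReal.rpow_natCast, ← ENNReal.rpow_mul]
    have e : ∀ x, ‖v x‖ₑ ^ (3 : ℝ) = ‖v x‖ₑ ^ 3 := fun x => by
      rw [show (3 : ℝ) = (3 : ℕ) by norm_num, ENNReal.rpow_natCast]
    simp only [e]
    norm_num
  have hg3 : (∫⁻ x in B, ‖v x‖ₑ ^ (3 : ℝ)) ^ (1 / 3 : ℝ) = (∫⁻ x in B, ‖v x‖ₑ ^ 3) ^ (3⁻¹ : ℝ) := by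
    have e : ∀ x, ‖v x‖ₑ ^ (3 : ℝ) = ‖v x‖ₑ ^ 3 := fun x => by
      rw [show (3 : ℝ) = (3 : ℕ) by norm_num, ENNReal.rpow_natCast]
    simp only [e, one_div]
  have hA := lintegral_enorm_cube_rpow_le v hv hv2
  have hBall := lintegral_ball_enorm_cube_rpow_le v hv hv2 x₀ R
  have hKsplit : ((K : ℝ≥0∞) ^ (3 / 2 : ℝ)) = (K : ℝ≥0∞) ^ (1 : ℝ) * (K : ℝ≥0∞) ^ (1 / 2 : ℝ) := by
    rw [← ENNReal.rpow_add_of_nonneg _ _ (by norm_num) (by norm_num)]; norm_num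
  have hFsplit : Fv ^ (3 / 4 : ℝ) = Fv ^ (1 / 2 : ℝ) * Fv ^ (4⁻¹ : ℝ) := by
    rw [← ENNReal.rpow_add_of_nonneg _ _ (by norm_num) (by norm_num)]; norm_num
  calc ∫⁻ x in B, ‖π x‖ₑ * ‖v x‖ₑ
      ≤ (∫⁻ x in B, ‖π x‖ₑ ^ (3 / 2 : ℝ)) ^ (1 / (3 / 2) : ℝ) *
          (∫⁻ x in B, ‖v x‖ₑ ^ (3 : ℝ)) ^ (1 / 3 : ℝ) := hH
    _ ≤ (C * eLpNorm v 3 volume ^ 2) * (∫⁻ x in B, ‖v x‖ₑ ^ 3) ^ (3⁻¹ : ℝ) := by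
        rw [← hg3]
        exact mul_le_mul' (hπB.trans hπ) le_rfl
    _ = C * (∫⁻ x, ‖v x‖ₑ ^ 3) ^ (2 / 3 : ℝ) * (∫⁻ x in B, ‖v x‖ₑ ^ 3) ^ (3⁻¹ : ℝ) := by
        rw [hv3]
    _ ≤ C * ((∫⁻ x, ‖v x‖ₑ ^ 2) ^ (1 / 2 : ℝ) * (((K : ℝ≥0∞) ^ (1 : ℝ)) * Fv ^ (1 / 2 : ℝ))) *
          ((∫⁻ x in B, ‖v x‖ₑ ^ 2) ^ (4⁻¹ : ℝ) * (((K : ℝ≥0∞) ^ (1 / 2 : ℝ)) * Fv ^ (4⁻¹ : ℝ))) := by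
        gcongr
    _ = C * (∫⁻ x, ‖v x‖ₑ ^ 2) ^ (1 / 2 : ℝ) * (∫⁻ x in B, ‖v x‖ₑ ^ 2) ^ (4⁻¹ : ℝ) *
          (((K : ℝ≥0∞) ^ (3 / 2 : ℝ)) * Fv ^ (3 / 4 : ℝ)) := by
        rw [hKsplit, hFsplit]; ring

/-- **`|p̃||u| ∈ L¹` of the slab**: if `p̃ ∈ L^{3/2}((0,T) × ℝ³)` and `u` is Leray–Hopf on `[0,T]`
(so `u ∈ L³` of the slab, tree `IsLerayHopfOn.memLp_three_uncurry_slab`), then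
`(t,x) ↦ ‖p̃(t,x)‖‖u(t,x)‖` is integrable on `(0,T) × ℝ³` (Hölder `(3/2, 3)`).
[cite: RobinsonRodrigoSadowski2016, Lemma 3.5] -/
theorem integrable_slab {ν T : ℝ}
    {u : ℝ → EuclideanSpace ℝ (Fin 3) → EuclideanSpace ℝ (Fin 3)}
    (hLH : IsLerayHopfOn T ν 0 (u 0) u) {q : ℝ → EuclideanSpace ℝ (Fin 3) → ℝ}
    (hq32 : MemLp (uncurry q) (3 / 2 : ℝ≥0∞)
      (volume.restrict (Ioo 0 T ×ˢ (univ : Set (EuclideanSpace ℝ (Fin 3)))))) :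
    Integrable (fun z : ℝ × EuclideanSpace ℝ (Fin 3) => ‖q z.1 z.2‖ * ‖u z.1 z.2‖)
      (volume.restrict (Ioo 0 T ×ˢ (univ : Set (EuclideanSpace ℝ (Fin 3))))) := by
  set μS : Measure (ℝ × EuclideanSpace ℝ (Fin 3)) :=
    volume.restrict (Ioo 0 T ×ˢ (univ : Set (EuclideanSpace ℝ (Fin 3)))) with hμS
  have hu3 : MemLp (uncurry u) 3 μS := hLH.memLp_three_uncurry_slab
  have hm : AEStronglyMeasurable
      (fun z : ℝ × EuclideanSpace ℝ (Fin 3) => ‖q z.1 z.2‖ * ‖u z.1 z.2‖) μS :=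
    hq32.1.norm.mul hu3.1.norm
  refine ⟨hm, hasFiniteIntegral_iff_enorm.2 ?_⟩
  have hH := ENNReal.lintegral_mul_le_Lp_mul_Lq μS
    (Real.holderConjugate_iff.2 ⟨by norm_num, by norm_num⟩ : (3 / 2 : ℝ).HolderConjugate 3)
    hq32.1.enorm hu3.1.enorm
  simp only [Pi.mul_apply] at hH
  have e : ∀ z : ℝ × EuclideanSpace ℝ (Fin 3),
      ‖(‖q z.1 z.2‖ * ‖u z.1 z.2‖)‖ₑ = ‖uncurry q z‖ₑ * ‖uncurry u z‖ₑ := fun z => by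
    rw [enorm_mul, enorm_norm, enorm_norm]; rfl
  simp only [e]
  refine lt_of_le_of_lt hH (ENNReal.mul_lt_top ?_ ?_)
  · refine ENNReal.rpow_lt_top_of_nonneg (by norm_num) (ne_of_lt ?_)
    have h := lintegral_rpow_enorm_lt_top_of_eLpNorm_lt_top (by norm_num : (3 / 2 : ℝ≥0∞) ≠ 0)
      (ENNReal.div_ne_top (by norm_num) (by norm_num)) hq32.eLpNorm_lt_top
    rwa [show ((3 / 2 : ℝ≥0∞)).toReal = (3 / 2 : ℝ) by rw [ENNReal.toReal_div]; norm_num] at h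
  · refine ENNReal.rpow_lt_top_of_nonneg (by norm_num) (ne_of_lt ?_)
    have h := lintegral_rpow_enorm_lt_top_of_eLpNorm_lt_top (by norm_num) (by norm_num)
      hu3.eLpNorm_lt_top
    rwa [ENNReal.toReal_ofNat] at h

/-- **Optimising Young**: if `X ≤ M (¾ c G + ¼ c⁻³ τ)` for every `c > 0` (`M, G ≥ 0`, `τ > 0`), then
`X ≤ M τ^{1/4} G^{3/4}` (`c = (τ/G)^{1/4}`; `G = 0` by `c → ∞`). The optimisation step of the
landed `CubicFlux.cubicFlux_le`, abstracted. [folklore] -/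
theorem young_optimise {X M τ G : ℝ} (hM : 0 ≤ M) (hτ : 0 < τ) (hG : 0 ≤ G)
    (h : ∀ c : ℝ, 0 < c → X ≤ M * (3 / 4 * c * G + 4⁻¹ * c⁻¹ ^ 3 * τ)) :
    X ≤ M * (τ ^ (1 / 4 : ℝ) * G ^ (3 / 4 : ℝ)) := by
  rcases hG.eq_or_lt with hG0 | hGpos
  · -- `G = 0`: let `c → ∞`
    rw [← hG0, Real.zero_rpow (by norm_num), mul_zero, mul_zero]
    refine le_of_forall_pos_le_add fun ε hε => ?_
    set M' : ℝ := M * (4⁻¹ * τ) with hM'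
    have hMnn : 0 ≤ M' := by positivity
    set c : ℝ := M' / ε + 1 with hcdef
    have hc : 0 < c := by positivity
    have hc1 : 1 ≤ c := by
      have : 0 ≤ M' / ε := by positivity
      linarith
    have hy := h c hc
    rw [← hG0, mul_zero, zero_add] at hy
    refine hy.trans ?_
    rw [zero_add]
    have hcinv : c⁻¹ ^ 3 ≤ c⁻¹ :=
      pow_le_of_le_one (inv_nonneg.2 hc.le) (inv_le_one_of_one_le₀ hc1) (by norm_num)
    have hMc : M' * c⁻¹ ≤ ε := by
      rw [mul_inv_le_iff₀ hc]
      have : ε * c = M' + ε := by rw [hcdef]; field_simp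
      linarith
    calc M * (4⁻¹ * c⁻¹ ^ 3 * τ) = M' * c⁻¹ ^ 3 := by rw [hM']; ring
      _ ≤ M' * c⁻¹ := mul_le_mul_of_nonneg_left hcinv hMnn
      _ ≤ ε := hMc
  · -- `G > 0`: `c = (τ/G)^{1/4}`
    set c : ℝ := (τ / G) ^ (4⁻¹ : ℝ) with hcdef
    have hc : 0 < c := Real.rpow_pos_of_pos (div_pos hτ hGpos) _
    have hc4 : c ^ 4 = τ / G := by
      rw [hcdef, ← Real.rpow_natCast, ← Real.rpow_mul (div_pos hτ hGpos).le]
      norm_num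
    have hGc : G = τ / c ^ 4 := by
      rw [hc4]; field_simp
    have hkey : 3 / 4 * c * G + 4⁻¹ * c⁻¹ ^ 3 * τ = τ ^ (1 / 4 : ℝ) * G ^ (3 / 4 : ℝ) := by
      have hc3 : (c ^ 4) ^ (3 / 4 : ℝ) = c ^ 3 := by
        rw [← Real.rpow_natCast c 4, ← Real.rpow_mul hc.le]
        norm_num
      have hτ1 : τ ^ (1 / 4 : ℝ) * τ ^ (3 / 4 : ℝ) = τ := by
        rw [← Real.rpow_add hτ]; norm_num
      rw [hGc, Real.div_rpow hτ.le (pow_nonneg hc.le 4), hc3,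
        show τ ^ (1 / 4 : ℝ) * (τ ^ (3 / 4 : ℝ) / c ^ 3) = (τ ^ (1 / 4 : ℝ) * τ ^ (3 / 4 : ℝ)) / c ^ 3
          by ring, hτ1]
      field_simp
      ring
    have hy := h c hc
    rwa [hkey] at hy

end PressureFlux

end Summit.NavierStokesRegularity.NavierStokesRegularity.Theorems

end
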